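import Mathlib
import Literature.NumberTheory.DiophantineGeometry.BombieriPilaProofs
import Summits.Parity.BatemanHorn.Theorems.IsogenyRedeiLambdaToCountCurves
import HarnessLib

/-!
# Proper prime-power values of an irreducible polynomial are sparse

Helper file for item stmt-Parity-0874 (`LambdaToCount`). For `f ∈ ℤ[X]` irreducible of degree
`d ≥ 1` we prove the power-saving bound

  `#{1 ≤ n ≤ x : f(n) = p^a for some prime p and some a ≥ 2} ≤ K(f) · x^{7/8}`  (`x ≥ 1`).

* Exponents `2 ≤ a ≤ 2d`: the points `(n, p)` are integral points of the absolutely irreducible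
  plane curve `X₁^a = f(X₀)` of degree `≥ max a d` in the box of side `A·x^⌈d/a⌉`
  (`A = Σ |coeff f|`), and Bombieri–Pila (`bombieriPila_card_integralPointsInBox_le`, proved in
  the tree) with `ε = 1/(8⌈d/a⌉)` gives `≪ x^{⌈d/a⌉/max(a,d) + 1/8} ≤ x^{7/8}`.
* Exponents `a ≥ 2d + 1`: then `p^{2d+1} ≤ f(n) ≤ A x^d` forces `p ≤ A(√x + 1)`, and for each
  prime `p` at most `d · (log₂(A x^d) + 1)` values `n ≤ x` have `f(n)` a power of `p`; in total
  `≪ √x · log x ≤ K x^{7/8}`.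
-/

open Finset Polynomial
open scoped Classical

namespace Summit.Parity.BatemanHorn.LambdaToCount

/-! ### Size of the values -/

/-- `A(f) = Σ_j |coeff_j f|`, written inline below as a sum over `range (natDegree f + 1)`:
`|f(n)| ≤ A(f) · x^d` for `|n| ≤ x`, `x ≥ 1`. -/
theorem abs_eval_le (f : ℤ[X]) {n : ℤ} {x : ℕ} (hn : |n| ≤ x) (hx : 1 ≤ x) :
    |f.eval n| ≤ (∑ j ∈ range (f.natDegree + 1), (f.coeff j).natAbs : ℕ) * (x : ℤ) ^ f.natDegree := by
  rw [eval_eq_sum_range, Nat.cast_sum, sum_mul]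
  refine (abs_sum_le_sum_abs _ _).trans (sum_le_sum fun j hj => ?_)
  rw [abs_mul, abs_pow, Int.natCast_natAbs]
  refine mul_le_mul_of_nonneg_left ?_ (abs_nonneg _)
  have hj' : j ≤ f.natDegree := Nat.lt_succ_iff.mp (mem_range.mp hj)
  calc |n| ^ j ≤ (x : ℤ) ^ j := pow_le_pow_left₀ (abs_nonneg n) hn j
    _ ≤ (x : ℤ) ^ f.natDegree := pow_le_pow_right₀ (by exact_mod_cast hx) hj'

/-- `(f(n)).toNat ≤ A(f) · x^d` for `1 ≤ n ≤ x`-type ranges (`n ≤ x`, `x ≥ 1`). -/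
theorem toNat_eval_le (f : ℤ[X]) {n x : ℕ} (hn : n ≤ x) (hx : 1 ≤ x) :
    (f.eval (n : ℤ)).toNat ≤ (∑ j ∈ range (f.natDegree + 1), (f.coeff j).natAbs) * x ^ f.natDegree := by
  have h := abs_eval_le f (n := n) (x := x) (by rw [Nat.abs_cast]; exact_mod_cast hn) hx
  have h' : f.eval (n : ℤ) ≤
      ((∑ j ∈ range (f.natDegree + 1), (f.coeff j).natAbs) * x ^ f.natDegree : ℕ) := by
    rw [Nat.cast_mul, Nat.cast_pow]
    exact (le_abs_self _).trans h
  exact Int.toNat_le.mpr h'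

/-- `A(f) ≥ 1` for `f ≠ 0` (the leading coefficient contributes `≥ 1`). -/
theorem one_le_sumNatAbs {f : ℤ[X]} (hf : f ≠ 0) :
    1 ≤ ∑ j ∈ range (f.natDegree + 1), (f.coeff j).natAbs := by
  have hmem : f.natDegree ∈ range (f.natDegree + 1) := mem_range.mpr (Nat.lt_succ_self _)
  refine le_trans ?_ (single_le_sum (f := fun j => (f.coeff j).natAbs) (fun _ _ => Nat.zero_le _) hmem)
  have : f.coeff f.natDegree ≠ 0 := by
    rw [coeff_natDegree]
    exact leadingCoeff_ne_zero.mpr hf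
  exact Int.natAbs_pos.mpr this

/-! ### Values equal to a constant, and values that are powers of a fixed prime -/

/-- A polynomial of degree `d ≥ 1` takes each value at most `d` times on `{1, …, x}`. -/
theorem card_filter_eval_eq_le {f : ℤ[X]} (hd : 0 < f.natDegree) (x : ℕ) (c : ℤ) :
    #((Icc 1 x).filter fun n : ℕ => f.eval (n : ℤ) = c) ≤ f.natDegree := by
  have hne : f - C c ≠ 0 := by
    intro h
    have := congrArg natDegree h
    rw [natDegree_sub_C, natDegree_zero] at this
    omega
  calc #((Icc 1 x).filter fun n : ℕ => f.eval (n : ℤ) = c)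
      ≤ (f - C c).roots.toFinset.card := by
        refine card_le_card_of_injOn (fun n : ℕ => (n : ℤ)) ?_ ?_
        · intro n hn
          rw [mem_coe, mem_filter] at hn
          rw [mem_coe, Multiset.mem_toFinset, mem_roots hne, IsRoot, eval_sub, eval_C, hn.2,
            sub_self]
        · intro m _ n _ h
          have h' : (m : ℤ) = n := h
          exact Nat.cast_injective h'
    _ ≤ Multiset.card (f - C c).roots := Multiset.toFinset_card_le _
    _ ≤ (f - C c).natDegree := card_roots' _
    _ = f.natDegree := natDegree_sub_C

/-- For a prime `p` (indeed any `p ≥ 2`) and `x ≥ 1`, at most `d · (log₂(A x^d) + 1)` integers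
`1 ≤ n ≤ x` have `f(n)` equal to a power of `p`. -/
theorem card_filter_eval_eq_pow_le {f : ℤ[X]} (hd : 0 < f.natDegree) {p : ℕ} (hp : 2 ≤ p)
    {x : ℕ} (hx : 1 ≤ x) :
    #((Icc 1 x).filter fun n : ℕ => ∃ b : ℕ, (f.eval (n : ℤ)).toNat = p ^ b) ≤
      (Nat.log 2 ((∑ j ∈ range (f.natDegree + 1), (f.coeff j).natAbs) * x ^ f.natDegree) + 1) *
        f.natDegree := by
  set M := (∑ j ∈ range (f.natDegree + 1), (f.coeff j).natAbs) * x ^ f.natDegree with hM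
  have hsub : ((Icc 1 x).filter fun n : ℕ => ∃ b : ℕ, (f.eval (n : ℤ)).toNat = p ^ b) ⊆
      (range (Nat.log 2 M + 1)).biUnion fun b =>
        (Icc 1 x).filter fun n : ℕ => f.eval (n : ℤ) = (p : ℤ) ^ b := by
    intro n hn
    rw [mem_filter] at hn
    obtain ⟨hn, b, hb⟩ := hn
    rw [mem_biUnion]
    refine ⟨b, mem_range.mpr (Nat.lt_succ_of_le ?_), mem_filter.mpr ⟨hn, ?_⟩⟩
    · have hle : p ^ b ≤ M := hb ▸ toNat_eval_le f (mem_Icc.mp hn).2 hx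
      exact (Nat.le_log_of_pow_le (by omega) hle).trans (Nat.log_anti_left (by norm_num) hp)
    · have hpos : 0 < (f.eval (n : ℤ)).toNat := by
        rw [hb]; positivity
      have : ((f.eval (n : ℤ)).toNat : ℤ) = f.eval (n : ℤ) :=
        Int.toNat_of_nonneg (le_of_lt (Int.lt_toNat.mp hpos |>.trans_le' le_rfl))
      rw [← this, hb]
      push_cast
      rfl
  calc #((Icc 1 x).filter fun n : ℕ => ∃ b : ℕ, (f.eval (n : ℤ)).toNat = p ^ b)
      ≤ #((range (Nat.log 2 M + 1)).biUnion fun b =>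
          (Icc 1 x).filter fun n : ℕ => f.eval (n : ℤ) = (p : ℤ) ^ b) := card_le_card hsub
    _ ≤ ∑ b ∈ range (Nat.log 2 M + 1), #((Icc 1 x).filter fun n : ℕ => f.eval (n : ℤ) = (p : ℤ) ^ b) :=
        card_biUnion_le
    _ ≤ ∑ _b ∈ range (Nat.log 2 M + 1), f.natDegree :=
        sum_le_sum fun b _ => card_filter_eval_eq_le hd x _
    _ = (Nat.log 2 M + 1) * f.natDegree := by rw [sum_const, card_range, smul_eq_mul]


/-! ### Large exponents: `a ≥ 2d + 1` -/

/-- Exponents `a ≥ 2d+1`: then `p^{2d+1} ≤ f(n) ≤ A x^d ≤ (A(√x+1))^{2d+1}`, so `p ≤ A(√x+1)`,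
and for each prime `p` at most `d(log₂(A x^d)+1)` values of `n` have `f(n)` a power of `p`. -/
theorem card_filter_largePow_le {f : ℤ[X]} (hd : 0 < f.natDegree) {x : ℕ} (hx : 1 ≤ x) :
    #((Icc 1 x).filter fun n : ℕ => ∃ p a : ℕ, p.Prime ∧ 2 * f.natDegree + 1 ≤ a ∧
        (f.eval (n : ℤ)).toNat = p ^ a) ≤
      ((∑ j ∈ range (f.natDegree + 1), (f.coeff j).natAbs) * (Nat.sqrt x + 1) + 1) *
        ((Nat.log 2 ((∑ j ∈ range (f.natDegree + 1), (f.coeff j).natAbs) * x ^ f.natDegree) + 1) *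
          f.natDegree) := by
  set A := ∑ j ∈ range (f.natDegree + 1), (f.coeff j).natAbs with hA
  set d := f.natDegree with hd'
  have hf0 : f ≠ 0 := by
    rintro rfl
    simp [hd'] at hd
  have hA1 : 1 ≤ A := one_le_sumNatAbs hf0
  have hsub : ((Icc 1 x).filter fun n : ℕ => ∃ p a : ℕ, p.Prime ∧ 2 * d + 1 ≤ a ∧
        (f.eval (n : ℤ)).toNat = p ^ a) ⊆
      ((range (A * (Nat.sqrt x + 1) + 1)).filter Nat.Prime).biUnion fun p =>
        (Icc 1 x).filter fun n : ℕ => ∃ b : ℕ, (f.eval (n : ℤ)).toNat = p ^ b := by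
    intro n hn
    rw [mem_filter] at hn
    obtain ⟨hn, p, a, hp, ha, hnp⟩ := hn
    rw [mem_biUnion]
    refine ⟨p, mem_filter.mpr ⟨mem_range.mpr (Nat.lt_succ_of_le ?_), hp⟩,
      mem_filter.mpr ⟨hn, a, hnp⟩⟩
    have h1 : p ^ a ≤ A * x ^ d := hnp ▸ toNat_eval_le f (mem_Icc.mp hn).2 hx
    have h2 : p ^ (2 * d + 1) ≤ p ^ a := Nat.pow_le_pow_right hp.pos ha
    have h3 : A * x ^ d ≤ (A * (Nat.sqrt x + 1)) ^ (2 * d + 1) := by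
      have hs : x ≤ (Nat.sqrt x + 1) ^ 2 := (Nat.lt_succ_sqrt' x).le
      calc A * x ^ d ≤ A * ((Nat.sqrt x + 1) ^ 2) ^ d :=
            Nat.mul_le_mul_left _ (Nat.pow_le_pow_left hs d)
        _ = A ^ 1 * (Nat.sqrt x + 1) ^ (2 * d) := by rw [← pow_mul, pow_one]
        _ ≤ A ^ (2 * d + 1) * (Nat.sqrt x + 1) ^ (2 * d + 1) :=
            Nat.mul_le_mul (Nat.pow_le_pow_right hA1 (by omega))
              (Nat.pow_le_pow_right (Nat.succ_pos _) (by omega))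
        _ = (A * (Nat.sqrt x + 1)) ^ (2 * d + 1) := by rw [mul_pow]
    exact (Nat.pow_le_pow_iff_left (by omega)).mp (h2.trans (h1.trans h3))
  calc #((Icc 1 x).filter fun n : ℕ => ∃ p a : ℕ, p.Prime ∧ 2 * d + 1 ≤ a ∧
          (f.eval (n : ℤ)).toNat = p ^ a)
      ≤ #(((range (A * (Nat.sqrt x + 1) + 1)).filter Nat.Prime).biUnion fun p =>
          (Icc 1 x).filter fun n : ℕ => ∃ b : ℕ, (f.eval (n : ℤ)).toNat = p ^ b) :=
        card_le_card hsub
    _ ≤ ∑ p ∈ (range (A * (Nat.sqrt x + 1) + 1)).filter Nat.Prime,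
          #((Icc 1 x).filter fun n : ℕ => ∃ b : ℕ, (f.eval (n : ℤ)).toNat = p ^ b) :=
        card_biUnion_le
    _ ≤ #((range (A * (Nat.sqrt x + 1) + 1)).filter Nat.Prime) •
          ((Nat.log 2 (A * x ^ d) + 1) * d) :=
        sum_le_card_nsmul _ _ _ fun p hp =>
          card_filter_eval_eq_pow_le hd (mem_filter.mp hp).2.two_le hx
    _ ≤ (A * (Nat.sqrt x + 1) + 1) * ((Nat.log 2 (A * x ^ d) + 1) * d) := by
        rw [smul_eq_mul]
        refine Nat.mul_le_mul_right _ ?_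
        exact (card_filter_le _ _).trans (card_range _).le

/-- Real-variable form of the large-exponent count: `≤ K · x^{7/8}` for `x ≥ 1`. -/
theorem card_filter_largePow_le_rpow {f : ℤ[X]} (hd : 0 < f.natDegree) :
    ∃ K : ℝ, ∀ x : ℕ, 1 ≤ x →
      (#((Icc 1 x).filter fun n : ℕ => ∃ p a : ℕ, p.Prime ∧ 2 * f.natDegree + 1 ≤ a ∧
          (f.eval (n : ℤ)).toNat = p ^ a) : ℝ) ≤ K * (x : ℝ) ^ (7 / 8 : ℝ) := by
  set A := ∑ j ∈ range (f.natDegree + 1), (f.coeff j).natAbs with hA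
  set d := f.natDegree with hd'
  have hf0 : f ≠ 0 := by
    rintro rfl
    simp [hd'] at hd
  have hA1 : 1 ≤ A := one_le_sumNatAbs hf0
  have hA1' : (1 : ℝ) ≤ A := by exact_mod_cast hA1
  have hd1 : (1 : ℝ) ≤ d := by exact_mod_cast hd
  refine ⟨(2 * A + 1) * ((2 * A + 6 * d + 1) * d), fun x hx => ?_⟩
  have hx' : (1 : ℝ) ≤ x := by exact_mod_cast hx
  have hx0 : (0 : ℝ) ≤ x := by positivity
  have h := card_filter_largePow_le hd hx
  rw [← hA, ← hd'] at h
  have hcast : (#((Icc 1 x).filter fun n : ℕ => ∃ p a : ℕ, p.Prime ∧ 2 * d + 1 ≤ a ∧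
      (f.eval (n : ℤ)).toNat = p ^ a) : ℝ) ≤
      ((A : ℝ) * (Nat.sqrt x + 1) + 1) * ((Nat.log 2 (A * x ^ d) + 1 : ℝ) * d) := by
    exact_mod_cast h
  -- first factor ≤ (2A+1) √x = (2A+1) x^{1/2}
  have hsqrt : (Nat.sqrt x : ℝ) ≤ (x : ℝ) ^ (1 / 2 : ℝ) := by
    rw [← Real.sqrt_eq_rpow]
    exact Real.nat_sqrt_le_real_sqrt
  have hhalf1 : (1 : ℝ) ≤ (x : ℝ) ^ (1 / 2 : ℝ) := Real.one_le_rpow hx' (by norm_num)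
  have h1 : (A : ℝ) * (Nat.sqrt x + 1) + 1 ≤ (2 * A + 1) * (x : ℝ) ^ (1 / 2 : ℝ) := by
    nlinarith
  -- second factor ≤ (2A + 6d + 1) x^{3/8}
  have h38 : (1 : ℝ) ≤ (x : ℝ) ^ (3 / 8 : ℝ) := Real.one_le_rpow hx' (by norm_num)
  have hlogx : Real.log x ≤ (x : ℝ) ^ (3 / 8 : ℝ) / (3 / 8) := Real.log_le_rpow_div hx0 (by norm_num)
  have hlogA : Real.log A ≤ A := (Real.log_le_sub_one_of_pos (by positivity)).trans (by linarith)
  have hM0 : (0 : ℝ) < A * (x : ℝ) ^ d := by positivity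
  have hlogM : Real.log ((A : ℝ) * (x : ℝ) ^ d) = Real.log A + d * Real.log x := by
    rw [Real.log_mul (by positivity) (by positivity), Real.log_pow]
  have hnatlog : (Nat.log 2 (A * x ^ d) : ℝ) ≤ 2 * (Real.log A + d * Real.log x) := by
    have := Real.natLog_le_logb (A * x ^ d) 2
    rw [Real.logb] at this
    push_cast at this
    rw [hlogM] at this
    have hlog2 : (1 / 2 : ℝ) < Real.log 2 := by
      have := Real.log_two_gt_d9
      linarith
    have hnum : 0 ≤ Real.log A + d * Real.log x := by
      have := Real.log_nonneg hA1'
      have := Real.log_nonneg hx'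
      positivity
    calc (Nat.log 2 (A * x ^ d) : ℝ) ≤ (Real.log A + d * Real.log x) / Real.log 2 := this
      _ ≤ (Real.log A + d * Real.log x) / (1 / 2) :=
          div_le_div_of_nonneg_left hnum (by norm_num) hlog2.le
      _ = 2 * (Real.log A + d * Real.log x) := by ring
  have h2 : (Nat.log 2 (A * x ^ d) + 1 : ℝ) ≤ (2 * A + 6 * d + 1) * (x : ℝ) ^ (3 / 8 : ℝ) := by
    have hdlog : (d : ℝ) * Real.log x ≤ d * ((x : ℝ) ^ (3 / 8 : ℝ) / (3 / 8)) :=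
      mul_le_mul_of_nonneg_left hlogx (by positivity)
    nlinarith
  have hprod : (x : ℝ) ^ (1 / 2 : ℝ) * (x : ℝ) ^ (3 / 8 : ℝ) = (x : ℝ) ^ (7 / 8 : ℝ) := by
    rw [← Real.rpow_add' hx0 (by norm_num)]
    norm_num
  calc (#((Icc 1 x).filter fun n : ℕ => ∃ p a : ℕ, p.Prime ∧ 2 * d + 1 ≤ a ∧
          (f.eval (n : ℤ)).toNat = p ^ a) : ℝ)
      ≤ ((A : ℝ) * (Nat.sqrt x + 1) + 1) * ((Nat.log 2 (A * x ^ d) + 1 : ℝ) * d) := hcast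
    _ ≤ ((2 * A + 1) * (x : ℝ) ^ (1 / 2 : ℝ)) * (((2 * A + 6 * d + 1) * (x : ℝ) ^ (3 / 8 : ℝ)) * d) := by
        gcongr
    _ = (2 * A + 1) * ((2 * A + 6 * d + 1) * d) * ((x : ℝ) ^ (1 / 2 : ℝ) * (x : ℝ) ^ (3 / 8 : ℝ)) := by
        ring
    _ = (2 * A + 1) * ((2 * A + 6 * d + 1) * d) * (x : ℝ) ^ (7 / 8 : ℝ) := by rw [hprod]

/-! ### Small exponents: Bombieri–Pila on `Y^a = f(X)` -/

open Literature.NumberTheory.DiophantineGeometry.Dioph in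
/-- Exponent `a ≥ 2` fixed: `#{1 ≤ n ≤ x : f(n) = p^a, p prime} ≤ K_a · x^{7/8}` by
Bombieri–Pila applied to the absolutely irreducible curve `X₁^a = f(X₀)` (degree `≥ max a d`)
in the box of side `A·x^⌈d/a⌉`, with `ε = 1/(8⌈d/a⌉)`. -/
theorem card_filter_eq_primePow_le {f : ℤ[X]} (hf : Irreducible f) (hd : 0 < f.natDegree)
    {a : ℕ} (ha : 2 ≤ a) :
    ∃ K : ℝ, ∀ x : ℕ, 1 ≤ x →
      (#((Icc 1 x).filter fun n : ℕ => ∃ p : ℕ, p.Prime ∧ (f.eval (n : ℤ)).toNat = p ^ a) : ℝ) ≤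
        K * (x : ℝ) ^ (7 / 8 : ℝ) := by
  set A := ∑ j ∈ range (f.natDegree + 1), (f.coeff j).natAbs with hA
  set d := f.natDegree with hd'
  set e := (d + a - 1) / a with he
  set m := max a d with hm
  set F : MvPolynomial (Fin 2) ℤ := MvPolynomial.X 1 ^ a - f.toMvPolynomial 0 with hF
  have hf0 : f ≠ 0 := by
    rintro rfl
    simp [hd'] at hd
  have hA1 : 1 ≤ A := one_le_sumNatAbs hf0
  have ha0 : 0 < a := by omega
  have hirr : IsAbsolutelyIrreducible F := isAbsolutelyIrreducible_X_pow_sub_toMvPolynomial hf hd ha0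
  have hdegF : m ≤ F.totalDegree := le_totalDegree_X_pow_sub_toMvPolynomial hd ha0
  have hm2 : 2 ≤ m := ha.trans (le_max_left _ _)
  have he1 : 1 ≤ e := (Nat.le_div_iff_mul_le (by omega)).mpr (by omega)
  have hε : (0 : ℝ) < 1 / (8 * e) := by positivity
  obtain ⟨B, hB0, hB⟩ :=
    bombieriPila_card_integralPointsInBox_le_holds F.totalDegree (hm2.trans hdegF) _ hε
  refine ⟨B * (A : ℝ) ^ (1 / (m : ℝ) + 1 / (8 * e)), fun x hx => ?_⟩
  set N := A * x ^ e with hN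
  have hxe : x ≤ x ^ e := Nat.le_self_pow (by omega) x
  have hN1 : 1 ≤ N := Nat.one_le_iff_ne_zero.mpr (by positivity)
  have hxN : x ≤ N := hxe.trans (Nat.le_mul_of_pos_left _ (by omega))
  -- the injection `n ↦ (n, p)`
  have hcard : #((Icc 1 x).filter fun n : ℕ => ∃ p : ℕ, p.Prime ∧ (f.eval (n : ℤ)).toNat = p ^ a) ≤
      #(integralPointsInBox F N) := by
    refine card_le_card_of_injOn
      (fun n : ℕ => ((n : ℤ), (((f.eval (n : ℤ)).toNat).minFac : ℤ))) ?_ ?_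
    · intro n hn
      rw [mem_coe, mem_filter] at hn
      obtain ⟨hn, p, hp, hnp⟩ := hn
      have hn' := mem_Icc.mp hn
      rw [mem_coe, mem_integralPointsInBox]
      simp only
      rw [hnp, hp.pow_minFac (by omega)]
      have hpa : p ^ a ≤ N ^ a := by
        calc p ^ a = (f.eval (n : ℤ)).toNat := hnp.symm
          _ ≤ A * x ^ d := toNat_eval_le f hn'.2 hx
          _ ≤ A ^ a * x ^ (e * a) :=
              Nat.mul_le_mul (Nat.le_self_pow (by omega) A)
                (Nat.pow_le_pow_right hx (le_ceilDiv_mul (a := a) (d := d) (by omega)))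
          _ = N ^ a := by rw [hN, mul_pow, pow_mul]
      have hpN : p ≤ N := (Nat.pow_le_pow_iff_left (by omega)).mp hpa
      refine ⟨⟨?_, ?_⟩, ?_⟩
      · rw [Nat.abs_cast]
        exact_mod_cast hn'.2.trans hxN
      · rw [Nat.abs_cast]
        exact_mod_cast hpN
      · rw [hF, eval_X_pow_sub_toMvPolynomial, sub_eq_zero]
        have hpos : 0 < (f.eval (n : ℤ)).toNat := by rw [hnp]; exact pow_pos hp.pos a
        have h0 : 0 ≤ f.eval (n : ℤ) := (Int.lt_toNat.mp hpos).le
        rw [← Int.toNat_of_nonneg h0, hnp]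
        push_cast
        rfl
    · intro n₁ _ n₂ _ h
      have h' : (n₁ : ℤ) = n₂ := congrArg Prod.fst h
      exact_mod_cast h'
  have hBP := hB F rfl hirr N hN1
  have hN1' : (1 : ℝ) ≤ N := by exact_mod_cast hN1
  have hx1 : (1 : ℝ) ≤ x := by exact_mod_cast hx
  have hA0 : (0 : ℝ) ≤ A := by positivity
  have hx0 : (0 : ℝ) ≤ x := by positivity
  -- the exponent: e * (1/m + 1/(8e)) ≤ 7/8
  have hexp : (e : ℝ) * (1 / (m : ℝ) + 1 / (8 * e)) ≤ 7 / 8 := by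
    have h43 : (4 : ℝ) * e ≤ 3 * m := by
      have := four_mul_ceilDiv_le (d := d) ha hd
      rw [← he, ← hm] at this
      exact_mod_cast this
    have hm0 : (0 : ℝ) < m := by positivity
    have he0 : (0 : ℝ) < e := by positivity
    rw [mul_add, mul_one_div, mul_one_div, show (e : ℝ) / (8 * e) = 1 / 8 by field_simp]
    have : (e : ℝ) / m ≤ 3 / 4 := by
      rw [div_le_div_iff₀ hm0 (by norm_num)]
      linarith
    linarith
  calc (#((Icc 1 x).filter fun n : ℕ => ∃ p : ℕ, p.Prime ∧ (f.eval (n : ℤ)).toNat = p ^ a) : ℝ)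
      ≤ #(integralPointsInBox F N) := by exact_mod_cast hcard
    _ ≤ B * (N : ℝ) ^ (1 / (F.totalDegree : ℝ) + 1 / (8 * e)) := hBP
    _ ≤ B * (N : ℝ) ^ (1 / (m : ℝ) + 1 / (8 * e)) := by
        refine mul_le_mul_of_nonneg_left (Real.rpow_le_rpow_of_exponent_le hN1' ?_) hB0.le
        have hm0 : (0 : ℝ) < m := by positivity
        have : (m : ℝ) ≤ F.totalDegree := by exact_mod_cast hdegF
        linarith [one_div_le_one_div_of_le hm0 this]
    _ = B * ((A : ℝ) ^ (1 / (m : ℝ) + 1 / (8 * e)) *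
          (x : ℝ) ^ ((e : ℝ) * (1 / (m : ℝ) + 1 / (8 * e)))) := by
        rw [hN, Nat.cast_mul, Nat.cast_pow, Real.mul_rpow hA0 (by positivity),
          Real.rpow_natCast_mul hx0]
    _ ≤ B * ((A : ℝ) ^ (1 / (m : ℝ) + 1 / (8 * e)) * (x : ℝ) ^ (7 / 8 : ℝ)) :=
        mul_le_mul_of_nonneg_left (mul_le_mul_of_nonneg_left
          (Real.rpow_le_rpow_of_exponent_le hx1 hexp) (by positivity)) hB0.le
    _ = B * (A : ℝ) ^ (1 / (m : ℝ) + 1 / (8 * e)) * (x : ℝ) ^ (7 / 8 : ℝ) := by ring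

/-! ### All proper prime powers -/

/-- **Proper prime-power values of an irreducible polynomial are sparse.** For `f ∈ ℤ[X]`
irreducible of positive degree there is `K` with
`#{1 ≤ n ≤ x : f(n) = p^a, p prime, a ≥ 2} ≤ K · x^{7/8}` for all `x ≥ 1`
(exponents `a ≤ 2 deg f` by Bombieri–Pila, larger exponents by the elementary count). -/
theorem card_filter_properPrimePow_le {f : ℤ[X]} (hf : Irreducible f) (hd : 0 < f.natDegree) :
    ∃ K : ℝ, ∀ x : ℕ, 1 ≤ x →
      (#((Icc 1 x).filter fun n : ℕ => ∃ p a : ℕ, p.Prime ∧ 2 ≤ a ∧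
          (f.eval (n : ℤ)).toNat = p ^ a) : ℝ) ≤ K * (x : ℝ) ^ (7 / 8 : ℝ) := by
  set d := f.natDegree with hd'
  have hsmall : ∀ a : ℕ, ∃ K : ℝ, 2 ≤ a → ∀ x : ℕ, 1 ≤ x →
      (#((Icc 1 x).filter fun n : ℕ => ∃ p : ℕ, p.Prime ∧ (f.eval (n : ℤ)).toNat = p ^ a) : ℝ) ≤
        K * (x : ℝ) ^ (7 / 8 : ℝ) := by
    intro a
    by_cases ha : 2 ≤ a
    · obtain ⟨K, hK⟩ := card_filter_eq_primePow_le hf hd ha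
      exact ⟨K, fun _ => hK⟩
    · exact ⟨0, fun h => absurd h ha⟩
  choose K hK using hsmall
  obtain ⟨Kb, hKb⟩ := card_filter_largePow_le_rpow (f := f) hd
  refine ⟨(∑ a ∈ Icc 2 (2 * d), K a) + Kb, fun x hx => ?_⟩
  have hsub : ((Icc 1 x).filter fun n : ℕ => ∃ p a : ℕ, p.Prime ∧ 2 ≤ a ∧
        (f.eval (n : ℤ)).toNat = p ^ a) ⊆
      ((Icc 2 (2 * d)).biUnion fun a =>
        (Icc 1 x).filter fun n : ℕ => ∃ p : ℕ, p.Prime ∧ (f.eval (n : ℤ)).toNat = p ^ a) ∪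
      ((Icc 1 x).filter fun n : ℕ => ∃ p a : ℕ, p.Prime ∧ 2 * d + 1 ≤ a ∧
        (f.eval (n : ℤ)).toNat = p ^ a) := by
    intro n hn
    rw [mem_filter] at hn
    obtain ⟨hn, p, a, hp, ha, hnp⟩ := hn
    rw [mem_union, mem_biUnion]
    by_cases had : a ≤ 2 * d
    · exact Or.inl ⟨a, mem_Icc.mpr ⟨ha, had⟩, mem_filter.mpr ⟨hn, p, hp, hnp⟩⟩
    · exact Or.inr (mem_filter.mpr ⟨hn, p, a, hp, by omega, hnp⟩)
  have hnat := (card_le_card hsub).trans ((card_union_le _ _).trans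
    (Nat.add_le_add_right card_biUnion_le _))
  calc (#((Icc 1 x).filter fun n : ℕ => ∃ p a : ℕ, p.Prime ∧ 2 ≤ a ∧
          (f.eval (n : ℤ)).toNat = p ^ a) : ℝ)
      ≤ (∑ a ∈ Icc 2 (2 * d),
            (#((Icc 1 x).filter fun n : ℕ => ∃ p : ℕ, p.Prime ∧ (f.eval (n : ℤ)).toNat = p ^ a) : ℝ)) +
          (#((Icc 1 x).filter fun n : ℕ => ∃ p a : ℕ, p.Prime ∧ 2 * d + 1 ≤ a ∧
            (f.eval (n : ℤ)).toNat = p ^ a) : ℝ) := by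
        exact_mod_cast hnat
    _ ≤ (∑ a ∈ Icc 2 (2 * d), K a * (x : ℝ) ^ (7 / 8 : ℝ)) + Kb * (x : ℝ) ^ (7 / 8 : ℝ) :=
        add_le_add (sum_le_sum fun a ha => hK a (mem_Icc.mp ha).1 x hx) (hKb x hx)
    _ = ((∑ a ∈ Icc 2 (2 * d), K a) + Kb) * (x : ℝ) ^ (7 / 8 : ℝ) := by
        rw [add_mul, sum_mul]

end Summit.Parity.BatemanHorn.LambdaToCount
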